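import Literature.Probability.Percolation.TriQuadProtection
import Literature.Probability.Percolation.TriQuadStagesBK
import HarnessLib

/-!
# The good event of a scale: few stages, all tips protected and fenced

Topic `Literature/Probability/Percolation`; family `crit-perc`, statement **crit-perc.S16**
(`Literature.Probability.Percolation.triTheta_exponent`). The per-scale "good" event of
Kesten's arm separation in P. Nolin's form (EJP 13 (2008), §4.4, proof of Lemma 15
[arXiv 0711.4948: Lemma 14]) for an abstract lattice quad `Q` and the two-colour stage
construction (`TriQuadStages.lean`, `TriQuadStagesBK.lean`, `TriQuadProtection.lean`):

> "`P(t ≥ T) ≤ (1-δ')^T ≤ δ/4` … `P(t ≥ u and c_u is not protected from above) ≤ (1-δ'')^{-C log η}`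
> … We choose `η₃` such that for each `η < η₃`, `T (1-δ'')^{-C log η} ≤ δ/4` … with probability at
> least `1 - δ/2` … any two of them are η-separated."

* `TriQuad.Good T K M₀ K' M₁ E ω` — fewer than `2T` stages, and for every stage `u < 2T` the
  four frame events: protection of the open tip (`ProtO K M₀ ω u`), of the closed tip
  (`ProtO K M₀ ωᶜ u`), and the fence frames leaving the free-space region `E` unforced
  (`ProtOE E K' M₁ ω u`, `ProtOE E K' M₁ ωᶜ u`).
* `TriQuad.real_not_good_le` — **the union bound**
  `P_p(¬ Good) ≤ P_p(LR)^T + P_{1-p}(LR)^T + 2T · ((1-a⁴)^K + (1-a⁴)^{K'} + (1-b⁴)^K + (1-b⁴)^{K'})`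
  where `a` (resp. `b`) bounds below the long-way crossing probabilities `P_p(LR(4·3^i M, 3^i M))`
  (resp. at `1 - p`) at the scales used (`real_numStages_ge_le`, `real_not_protO_le`,
  `real_not_protOE_le`, colour exchange `sitePercolation_real_preimage_compl`).

## References

* P. Nolin, Near-critical percolation in two dimensions, *Electron. J. Probab.* 13 (2008), §4.4,
  proof of Lemma 15 [arXiv 0711.4948: Lemma 14] [Nolin2008].
* H. Kesten, Scaling relations for 2D-percolation, *Comm. Math. Phys.* 109 (1987), Lemma 2
  [KestenScalingCMP1987].

## Mathlib / tree

Tree: `TriQuad.numStages`, `real_numStages_ge_le` (`TriQuadStagesBK.lean`), `TriQuad.ProtO`,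
`ProtOE`, `real_not_protO_le`, `real_not_protOE_le` (`TriQuadProtection.lean`),
`sitePercolation_real_preimage_compl` (`TriHexLemma.lean`). Mathlib: `measureReal_union_le`,
`measureReal_biUnion_finset_le`.
-/

noncomputable section

open MeasureTheory Set

namespace Literature.Probability.Percolation

open LatticeModels

namespace TriQuad

variable {Q : TriQuad}

variable (Q) in
/-- **The good event of a scale**: fewer than `2T` stages, and every stage's open and closed tips
are protected (`K` scales from `M₀`) and fenced (`K'` scales from `M₁`, region `E` unforced). [cite: Nolin2008, §4.4, proof of Lemma 15 (arXiv 0711.4948: Lemma 14)] -/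
def Good (T K M₀ K' M₁ : ℕ) (E : Set (Site 2)) (ω : Set (Site 2)) : Prop :=
  Q.numStages ω < 2 * T ∧ ∀ u < 2 * T,
    Q.ProtO K M₀ ω u ∧ Q.ProtO K M₀ ωᶜ u ∧ Q.ProtOE E K' M₁ ω u ∧ Q.ProtOE E K' M₁ ωᶜ u

/-- Complement of the good event as a union. [folklore] -/
theorem setOf_not_good_subset (T K M₀ K' M₁ : ℕ) (E : Set (Site 2)) :
    {ω | ¬ Q.Good T K M₀ K' M₁ E ω} ⊆
      {ω | 2 * T ≤ Q.numStages ω} ∪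
        ⋃ u ∈ Finset.range (2 * T),
          ({ω | ¬ Q.ProtO K M₀ ω u} ∪ compl ⁻¹' {ω | ¬ Q.ProtO K M₀ ω u} ∪
            ({ω | ¬ Q.ProtOE E K' M₁ ω u} ∪ compl ⁻¹' {ω | ¬ Q.ProtOE E K' M₁ ω u})) := by
  intro ω hω
  simp only [Good, not_and, not_forall, mem_setOf_eq] at hω
  by_cases hT : Q.numStages ω < 2 * T
  · obtain ⟨u, hu, h⟩ := hω hT
    right
    simp only [mem_iUnion, Finset.mem_range, mem_union, mem_setOf_eq, mem_preimage, exists_prop]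
    refine ⟨u, hu, ?_⟩
    tauto
  · left; simp only [mem_setOf_eq]; omega

/-- **The good event fails with small probability** (union bound):
`P_p(¬ Good) ≤ P_p(LR)^T + P_{1-p}(LR)^T + 2T · ((1-a⁴)^K + (1-b⁴)^K + (1-a⁴)^{K'} + (1-b⁴)^{K'})`,
where `a ≤ P_p(LR(4·3^i M₀, 3^i M₀))` (`i < K`) and `a ≤ P_p(LR(4·3^i M₁, 3^i M₁))` (`i < K'`),
and `b` likewise at the dual parameter `1 - p`. [cite: Nolin2008, §4.4, proof of Lemma 15 ("with probability at least 1 - δ/2"; arXiv 0711.4948: Lemma 14)] -/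
theorem real_not_good_le (p : unitInterval) (T K : ℕ) {M₀ : ℕ} (hM₀ : 1 ≤ M₀) (K' : ℕ) {M₁ : ℕ} (hM₁ : 1 ≤ M₁)
    (E : Set (Site 2)) {a b : ℝ} (ha : 0 ≤ a) (ha1 : a ≤ 1) (hb : 0 ≤ b) (hb1 : b ≤ 1)
    (ha₀ : ∀ i < K, a ≤ triLRCrossingProb p (4 * (3 ^ i * M₀)) (3 ^ i * M₀))
    (ha₁ : ∀ i < K', a ≤ triLRCrossingProb p (4 * (3 ^ i * M₁)) (3 ^ i * M₁))
    (hb₀ : ∀ i < K, b ≤ triLRCrossingProb (unitInterval.symm p) (4 * (3 ^ i * M₀)) (3 ^ i * M₀))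
    (hb₁ : ∀ i < K', b ≤ triLRCrossingProb (unitInterval.symm p) (4 * (3 ^ i * M₁)) (3 ^ i * M₁)) :
    (triSitePercolation p).real {ω | ¬ Q.Good T K M₀ K' M₁ E ω} ≤
      ((triSitePercolation p).real {ξ | Q.LRPath ξ}) ^ T +
        ((triSitePercolation (unitInterval.symm p)).real {ξ | Q.LRPath ξ}) ^ T +
        2 * T * ((1 - a ^ 4) ^ K + (1 - b ^ 4) ^ K + ((1 - a ^ 4) ^ K' + (1 - b ^ 4) ^ K')) := by
  set μ := triSitePercolation p with hμ
  have hstage := real_numStages_ge_le (Q := Q) p T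
  have hterm : ∀ u : ℕ, μ.real ({ω | ¬ Q.ProtO K M₀ ω u} ∪ compl ⁻¹' {ω | ¬ Q.ProtO K M₀ ω u} ∪
      ({ω | ¬ Q.ProtOE E K' M₁ ω u} ∪ compl ⁻¹' {ω | ¬ Q.ProtOE E K' M₁ ω u})) ≤
      (1 - a ^ 4) ^ K + (1 - b ^ 4) ^ K + ((1 - a ^ 4) ^ K' + (1 - b ^ 4) ^ K') := by
    intro u
    have h1 : μ.real {ω | ¬ Q.ProtO K M₀ ω u} ≤ (1 - a ^ 4) ^ K := real_not_protO_le p K hM₀ u ha ha1 ha₀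
    have h2 : μ.real (compl ⁻¹' {ω | ¬ Q.ProtO K M₀ ω u}) ≤ (1 - b ^ 4) ^ K := by
      rw [hμ]; unfold triSitePercolation
      rw [sitePercolation_real_preimage_compl]
      exact real_not_protO_le (unitInterval.symm p) K hM₀ u hb hb1 hb₀
    have h3 : μ.real {ω | ¬ Q.ProtOE E K' M₁ ω u} ≤ (1 - a ^ 4) ^ K' := real_not_protOE_le p E K' hM₁ u ha ha1 ha₁
    have h4 : μ.real (compl ⁻¹' {ω | ¬ Q.ProtOE E K' M₁ ω u}) ≤ (1 - b ^ 4) ^ K' := by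
      rw [hμ]; unfold triSitePercolation
      rw [sitePercolation_real_preimage_compl]
      exact real_not_protOE_le (unitInterval.symm p) E K' hM₁ u hb hb1 hb₁
    calc _ ≤ μ.real ({ω | ¬ Q.ProtO K M₀ ω u} ∪ compl ⁻¹' {ω | ¬ Q.ProtO K M₀ ω u}) +
          μ.real ({ω | ¬ Q.ProtOE E K' M₁ ω u} ∪ compl ⁻¹' {ω | ¬ Q.ProtOE E K' M₁ ω u}) :=
          measureReal_union_le _ _
      _ ≤ (μ.real {ω | ¬ Q.ProtO K M₀ ω u} + μ.real (compl ⁻¹' {ω | ¬ Q.ProtO K M₀ ω u})) +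
          (μ.real {ω | ¬ Q.ProtOE E K' M₁ ω u} + μ.real (compl ⁻¹' {ω | ¬ Q.ProtOE E K' M₁ ω u})) :=
          add_le_add (measureReal_union_le _ _) (measureReal_union_le _ _)
      _ ≤ _ := by linarith
  calc μ.real {ω | ¬ Q.Good T K M₀ K' M₁ E ω}
      ≤ μ.real ({ω | 2 * T ≤ Q.numStages ω} ∪ ⋃ u ∈ Finset.range (2 * T),
          ({ω | ¬ Q.ProtO K M₀ ω u} ∪ compl ⁻¹' {ω | ¬ Q.ProtO K M₀ ω u} ∪
            ({ω | ¬ Q.ProtOE E K' M₁ ω u} ∪ compl ⁻¹' {ω | ¬ Q.ProtOE E K' M₁ ω u}))) :=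
        measureReal_mono (setOf_not_good_subset T K M₀ K' M₁ E) (measure_ne_top _ _)
    _ ≤ μ.real {ω | 2 * T ≤ Q.numStages ω} + μ.real (⋃ u ∈ Finset.range (2 * T),
          ({ω | ¬ Q.ProtO K M₀ ω u} ∪ compl ⁻¹' {ω | ¬ Q.ProtO K M₀ ω u} ∪
            ({ω | ¬ Q.ProtOE E K' M₁ ω u} ∪ compl ⁻¹' {ω | ¬ Q.ProtOE E K' M₁ ω u}))) :=
        measureReal_union_le _ _
    _ ≤ μ.real {ω | 2 * T ≤ Q.numStages ω} + ∑ u ∈ Finset.range (2 * T),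
          μ.real ({ω | ¬ Q.ProtO K M₀ ω u} ∪ compl ⁻¹' {ω | ¬ Q.ProtO K M₀ ω u} ∪
            ({ω | ¬ Q.ProtOE E K' M₁ ω u} ∪ compl ⁻¹' {ω | ¬ Q.ProtOE E K' M₁ ω u})) :=
        add_le_add_right (measureReal_biUnion_finset_le _ _) _
    _ ≤ (μ.real {ξ | Q.LRPath ξ} ^ T + (triSitePercolation (unitInterval.symm p)).real {ξ | Q.LRPath ξ} ^ T) +
          ∑ _u ∈ Finset.range (2 * T), ((1 - a ^ 4) ^ K + (1 - b ^ 4) ^ K + ((1 - a ^ 4) ^ K' + (1 - b ^ 4) ^ K')) :=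
        add_le_add hstage (Finset.sum_le_sum fun u _ => hterm u)
    _ = _ := by rw [Finset.sum_const, Finset.card_range, nsmul_eq_mul]; push_cast; ring

end TriQuad

end Literature.Probability.Percolation
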